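import Literature.AlgebraicGeometry.Motives.AbelianVarietyPermutationPowerReciprocity
import HarnessLib

/-!
# Induced actions `X = Ind_H^G Y` on abelian varieties (systems of imprimitivity): the imprimitivity calculus,
# the `ℓ`-adic character `χ_X(g) = Σ_{t ∈ T^g} Tr(ι_t ρ(g) π_t)`, THE CHARACTER OF AN INDUCED ACTION
# `|H| · χ_X(g) = Σ_{x ∈ G, x⁻¹gx ∈ H} χ_Y(x⁻¹ g x)` (Serre Thm. 12), Frobenius reciprocity against class functions,
# and `dim B_G(Ind_H^G Y) = dim B_H(Y)`

Let `G` act on a finite set `T` and let `X = ⊕_{t ∈ T} Y_t` be a power of an abelian variety `Y` over a field `K` (a bicone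
`b` over `(Y)_{t ∈ T}` with **`Σ_t π_t ≫ ι_t = 𝟙_X`** (`hb`), as in `Motives/AbelianVarietyPermutationPowerHom`) carrying an
action `ρ : G → End X` that PERMUTES THE SUMMANDS ALONG `T`:

  **`ι_t ≫ ρ(g) ≫ π_u = 0` whenever `u ≠ g t`**   (`hρ`; "`ρ(g) Y_t ⊆ Y_{g t}`"),

Serre's definition of an induced representation (§3.3: "`V = ⊕_{σ ∈ G/H} W_σ`", "`ρ_s W_σ = W_{sσ}`"; §7.1 Prop. 19: a direct
sum of subspaces permuted transitively by `G` is induced from the stabiliser `H` of one of them) transported to the additive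
category of abelian varieties: for `T` transitive with `t₀ ∈ T`, `H = Stab(t₀)`, the variety `X` IS `Ind_H^G Y` for the
action `α : H → End Y`, **`α(h) = ι_{t₀} ≫ ρ(h) ≫ π_{t₀}`**, of `H` on the summand `Y = Y_{t₀}` (§1: `α` is multiplicative,
`exists_stabilizerAction`).  The permutation powers `A^S` of `Motives/AbelianVarietyPermutationPower*` (`ι_s ≫ ρ(g) = ι_{g s}`)
are the case of the TRIVIAL `H`-action (`of_permAction`: `α = 1`), the twisted powers `ι_s ≫ ρ(g) = β(g) ≫ ι_{g s}` the case
`α = β|_H` (`of_twistedPermAction`); a non-transitive `T` is a sum of induced actions over the orbits, and restricting `ρ` to a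
subgroup `L ≤ G` keeps the hypothesis (`restrict`) — Mackey's `Res_L Ind_H^G Y = ⊕_{LgH} Ind_{L ∩ gHg⁻¹}^L Y^g` is the orbit
decomposition of `T = G/H` under `L`.  With the TRANSFER MAPS **`φ_{g,t} = ι_t ≫ ρ(g) ≫ π_{g t} : Y_t → Y_{g t}`** this file proves
(no definition is introduced; `ρ`, `hρ` are hypotheses, shown consistent by the examples of §1):

* §1 the imprimitivity calculus: **`ι_t ≫ ρ(g) = φ_{g,t} ≫ ι_{g t}`**, **`ρ(g) ≫ π_u = π_{g⁻¹u} ≫ φ_{g,g⁻¹u}`**, the cocycle rule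
  **`φ_{g,t} ≫ φ_{g',gt} = φ_{g'g,t}`**, `φ_{1,t} = 𝟙`, `φ_{g,t}` is an isomorphism with inverse `φ_{g⁻¹,gt}`, and on the
  stabiliser `(ι_t ρ(h) π_t) ≫ (ι_t ρ(h') π_t) = ι_t ρ(h'h) π_t`: the stabiliser acts on `Y_t` (`exists_stabilizerAction`,
  `stabilizerAction_unique`);
* §2 the `ℓ`-adic character (`ℓ` invertible in `K`): **`Tr(ρ(g) | T_ℓ X) = Σ_{t ∈ T^g} Tr(ι_t ρ(g) π_t | T_ℓ Y)`** (only the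
  fixed summands contribute to the trace — the proof of Serre's Thm. 12), the conjugation rule
  **`Tr(ι_{xt} ρ(g) π_{xt}) = Tr(ι_t ρ(x⁻¹gx) π_t)`** for `g` fixing `x t`, and THE INDUCED CHARACTER FORMULA for transitive `T`:
  **`|H| · Tr(ρ(g) | T_ℓ X) = Σ_{x ∈ G, (x⁻¹gx) t₀ = t₀} Tr(ι_{t₀} ρ(x⁻¹gx) π_{t₀} | T_ℓ Y)`** = `|H| · (Ind_H^G χ_Y)(g)`
  (`card_stabilizer_mul_trace_tateModuleMap_asHom_eq_sum`; Serre Thm. 12: `χ_ρ(u) = h⁻¹ Σ_{s⁻¹us ∈ H} χ_θ(s⁻¹us)`), and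
  **`dim X = [G : H] · dim Y`** (`dim_eq_index_stabilizer_mul`; "`dim V = (G : H) dim W`");
* §3 FROBENIUS RECIPROCITY against a class function `c` on `G` (`c(x⁻¹gx) = c(g)`, values in `ℤ_ℓ`):
  **`|H| · Σ_{g ∈ G} c(g) χ_X(g) = |G| · Σ_{h ∈ H} c(h) χ_Y(h)`** (`⟨c, Ind χ_Y⟩_G = ⟨Res c, χ_Y⟩_H`, Serre Thm. 13), in particular
  `|H| Σ_g χ_X(g) = |G| Σ_h χ_Y(h)`, and — prime-free — **`dim B_G(X) = dim B_H(Y)`** for the Kani–Rosen factors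
  `B_G(X) = Im Σ_g ρ(g)`, `B_H(Y) = Im Σ_h α(h)` (`dim_image_normG_eq_dim_image_norm_stabilizer`: "`(Ind W)^G ≅ W^H`";
  `|G| · 2 dim B_G = Σ_g χ(g)` is the tree's `Motives/AbelianVarietyTateModuleTraceDimensionFormula`).

Scope (stated, not hidden).  `T` finite, `G` arbitrary in §1 and finite where sums over `G` occur; `K` any field; the
isotypical components of `Ind_H^G Y`, the `Hom`-side characters and Frobenius reciprocity for `Hom_G` are the sequels'.

## References

* [SerreLinearRepresentations1977] J.-P. Serre, *Linear Representations of Finite Groups*, GTM 42 (1977): §3.3 Definition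
  ("`ρ` is induced by `θ` if `V = ⊕_{σ ∈ G/H} W_σ`"; "`dim(V) = (G : H) · dim(W)`"; Examples 1–2: the regular and the permutation
  representation on `G/H` are induced from the regular / unit representation of `H`), Thm. 11, Thm. 12 (character of an induced
  representation), §7.1 Prop. 19 (transitively permuted summands ⇒ induced from the stabiliser), §7.2 Thm. 13 (Frobenius
  reciprocity) and Remark (1), Prop. 22 (`Res Ind`).  Held: `book:serre1977-linear-representations-finite-groups`, PDF pp. 30–31,
  50–53 read 2026-08-28.
* [LangeRodriguez2022] H. Lange, R. E. Rodríguez, *Decomposition of Jacobians by Prym Varieties*, LNM 2310 (2022), §2.9.1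
  Prop. 2.9.3 (PDF p. 46: `dim B_W` from `⟨ρ, W⟩`), §3.5 (induced actions for intermediate covers).
* [KaniRosen1989] E. Kani, M. Rosen, *Idempotent relations and factors of Jacobians*, Math. Ann. 284 (1989), §3 Thm. B (`ε_H`).
* [DokchitserEtAl2022] V. Dokchitser, H. Green, A. Konstantinou, A. Morgan, *Parity of ranks of Jacobians of curves*,
  arXiv:2211.06357, §3 (`V_ℓ(B_H) ≅ V_ℓ(X)^H`).
* [MumfordAV1970] D. Mumford, *Abelian Varieties* (1970), §19 Thm. 3 (p. 176), Thm. 4 (p. 180).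
-/

noncomputable section

open CategoryTheory CategoryTheory.Limits MulAction
open Literature.NumberTheory.DiophantineGeometry

universe u

namespace Literature.AlgebraicGeometry.Motives

namespace AbelianVariety

namespace Imprimitive

variable {K : Type u} [Field K]

/-! ## §1 Systems of imprimitivity: `ι_t ≫ ρ(g) = φ_{g,t} ≫ ι_{g t}` and the transfer cocycle -/

section Calculus

variable {Y : AbelianVariety K} {T : Type} [Fintype T] (b : Bicone (fun _ : T ↦ Y))
  {G : Type} [Group G] [MulAction G T] (ρ : G →* End b.pt)

/-- **`ρ(g)` maps the summand `Y_t` into `Y_{g t}`: `ι_t ≫ ρ(g) = φ_{g,t} ≫ ι_{g t}`** with the transfer map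
`φ_{g,t} = ι_t ≫ ρ(g) ≫ π_{g t}` ("`ρ_s W_σ = W_{sσ}`"). [cite: SerreLinearRepresentations1977, §3.3 Definition and §7.1 Prop. 19] -/
theorem ι_comp_asHom_eq (hb : ∑ t, b.π t ≫ b.ι t = 𝟙 b.pt)
    (hρ : ∀ (g : G) (t u : T), g • t ≠ u → b.ι t ≫ End.asHom (ρ g) ≫ b.π u = 0) (g : G) (t : T) :
    b.ι t ≫ End.asHom (ρ g) = (b.ι t ≫ End.asHom (ρ g) ≫ b.π (g • t)) ≫ b.ι (g • t) := by
  conv_lhs => rw [eq_sum_comp_π_comp_ι b hb (b.ι t ≫ End.asHom (ρ g))]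
  rw [Finset.sum_eq_single (g • t) (fun u _ hu ↦ by
      rw [Category.assoc (b.ι t), hρ g t u (Ne.symm hu), zero_comp])
    (fun h ↦ absurd (Finset.mem_univ _) h)]
  simp only [Category.assoc]

/-- **`ρ(g) ≫ π_u = π_{g⁻¹ u} ≫ φ_{g, g⁻¹u}`**: the `u`-th component of `ρ(g) x` only depends on the `g⁻¹u`-th component of `x`.
[cite: SerreLinearRepresentations1977, §3.3 Definition (i)] -/
theorem asHom_comp_π_eq (hb : ∑ t, b.π t ≫ b.ι t = 𝟙 b.pt)
    (hρ : ∀ (g : G) (t u : T), g • t ≠ u → b.ι t ≫ End.asHom (ρ g) ≫ b.π u = 0) (g : G) (u : T) :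
    End.asHom (ρ g) ≫ b.π u = b.π (g⁻¹ • u) ≫ b.ι (g⁻¹ • u) ≫ End.asHom (ρ g) ≫ b.π u := by
  conv_lhs => rw [eq_sum_π_comp_ι_comp b hb (End.asHom (ρ g) ≫ b.π u)]
  rw [Finset.sum_eq_single (g⁻¹ • u) (fun t _ ht ↦ by
      rw [hρ g t u (fun h ↦ ht (eq_inv_smul_iff.2 h)), comp_zero])
    (fun h ↦ absurd (Finset.mem_univ _) h)]

/-- **The transfer maps form a cocycle: `φ_{g,t} ≫ φ_{g',g t} = φ_{g'g,t}`** (`ρ(g'g) = ρ(g') ρ(g)` restricted to `Y_t`).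
[cite: SerreLinearRepresentations1977, §3.3 Definition] -/
theorem transfer_comp_transfer (hb : ∑ t, b.π t ≫ b.ι t = 𝟙 b.pt)
    (hρ : ∀ (g : G) (t u : T), g • t ≠ u → b.ι t ≫ End.asHom (ρ g) ≫ b.π u = 0) (g g' : G) (t : T) :
    (b.ι t ≫ End.asHom (ρ g) ≫ b.π (g • t)) ≫ (b.ι (g • t) ≫ End.asHom (ρ g') ≫ b.π (g' • g • t)) =
      b.ι t ≫ End.asHom (ρ (g' * g)) ≫ b.π (g' • g • t) := by
  have h := ι_comp_asHom_eq b ρ hb hρ g t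
  calc (b.ι t ≫ End.asHom (ρ g) ≫ b.π (g • t)) ≫ (b.ι (g • t) ≫ End.asHom (ρ g') ≫ b.π (g' • g • t))
      = (b.ι t ≫ End.asHom (ρ g)) ≫ End.asHom (ρ g') ≫ b.π (g' • g • t) := by
        rw [h]; simp only [Category.assoc]
    _ = b.ι t ≫ End.asHom (ρ (g' * g)) ≫ b.π (g' • g • t) := by
        rw [asHom_map_mul_eq_comp]; simp only [Category.assoc]

omit [Fintype T] [MulAction G T] in
/-- `φ_{1,t} = ι_t ≫ ρ(1) ≫ π_t = 𝟙`. [cite: SerreLinearRepresentations1977, §3.3 Definition] -/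
theorem transfer_one (t : T) : b.ι t ≫ End.asHom (ρ 1) ≫ b.π t = 𝟙 Y := by
  rw [asHom_map_one_eq_id, Category.id_comp]
  exact bicone_ι_π_self b t

/-- **`φ_{g,t}` is an isomorphism `Y_t ≅ Y_{g t}` with inverse `φ_{g⁻¹, g t}`**: `φ_{g,t} ≫ φ_{g⁻¹,gt} = 𝟙` ("the `ρ_r W` are
isomorphic copies of `W`"). [cite: SerreLinearRepresentations1977, §3.3 Definition (ii)] -/
theorem transfer_comp_transfer_inv (hb : ∑ t, b.π t ≫ b.ι t = 𝟙 b.pt)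
    (hρ : ∀ (g : G) (t u : T), g • t ≠ u → b.ι t ≫ End.asHom (ρ g) ≫ b.π u = 0) (g : G) (t : T) :
    (b.ι t ≫ End.asHom (ρ g) ≫ b.π (g • t)) ≫ (b.ι (g • t) ≫ End.asHom (ρ g⁻¹) ≫ b.π t) = 𝟙 Y := by
  have h := transfer_comp_transfer b ρ hb hρ g g⁻¹ t
  rw [inv_smul_smul, inv_mul_cancel, asHom_map_one_eq_id, Category.id_comp] at h
  rw [h]
  exact bicone_ι_π_self b t

/-- `φ_{g⁻¹,gt} ≫ φ_{g,t} = 𝟙`: the other composite. [cite: SerreLinearRepresentations1977, §3.3 Definition (ii)] -/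
theorem transfer_inv_comp_transfer (hb : ∑ t, b.π t ≫ b.ι t = 𝟙 b.pt)
    (hρ : ∀ (g : G) (t u : T), g • t ≠ u → b.ι t ≫ End.asHom (ρ g) ≫ b.π u = 0) (g : G) (t : T) :
    (b.ι (g • t) ≫ End.asHom (ρ g⁻¹) ≫ b.π t) ≫ (b.ι t ≫ End.asHom (ρ g) ≫ b.π (g • t)) = 𝟙 Y := by
  have h := transfer_comp_transfer b ρ hb hρ g⁻¹ g (g • t)
  rw [inv_smul_smul, mul_inv_cancel, asHom_map_one_eq_id, Category.id_comp] at h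
  rw [h]
  exact bicone_ι_π_self b (g • t)

/-- **The stabiliser of `t` acts on the summand `Y_t`**: for `h t = t = h' t`,
`(ι_t ρ(h) π_t) ≫ (ι_t ρ(h') π_t) = ι_t ρ(h'h) π_t` ("`W` is stable under `H`"; composition in `End` is reversed).
[cite: SerreLinearRepresentations1977, §7.1 Prop. 19] -/
theorem transfer_comp_transfer_of_smul_eq (hb : ∑ t, b.π t ≫ b.ι t = 𝟙 b.pt)
    (hρ : ∀ (g : G) (t u : T), g • t ≠ u → b.ι t ≫ End.asHom (ρ g) ≫ b.π u = 0) {h h' : G} {t : T}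
    (hh : h • t = t) (hh' : h' • t = t) :
    (b.ι t ≫ End.asHom (ρ h) ≫ b.π t) ≫ (b.ι t ≫ End.asHom (ρ h') ≫ b.π t) =
      b.ι t ≫ End.asHom (ρ (h' * h)) ≫ b.π t := by
  have key := transfer_comp_transfer b ρ hb hρ h h' t
  rw [hh, hh'] at key
  exact key

/-- **Existence of the stabiliser action `α : Stab(t) → End Y`, `α(h) = ι_t ≫ ρ(h) ≫ π_t`** (a monoid homomorphism by the
cocycle rule): `X` is induced from the `H`-variety `(Y, α)`, `H = Stab(t)`, when `T` is transitive.
[cite: SerreLinearRepresentations1977, §7.1 Prop. 19] -/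
theorem exists_stabilizerAction (hb : ∑ t, b.π t ≫ b.ι t = 𝟙 b.pt)
    (hρ : ∀ (g : G) (t u : T), g • t ≠ u → b.ι t ≫ End.asHom (ρ g) ≫ b.π u = 0) (t : T) :
    ∃ α : stabilizer G t →* End Y, ∀ h : stabilizer G t, End.asHom (α h) = b.ι t ≫ End.asHom (ρ h) ≫ b.π t := by
  refine ⟨{ toFun := fun h ↦ End.of (b.ι t ≫ End.asHom (ρ h) ≫ b.π t)
            map_one' := ?_
            map_mul' := ?_ }, fun h ↦ rfl⟩
  · change b.ι t ≫ End.asHom (ρ ((1 : stabilizer G t) : G)) ≫ b.π t = 𝟙 Y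
    rw [OneMemClass.coe_one]
    exact transfer_one b ρ t
  · intro h h'
    change b.ι t ≫ End.asHom (ρ ((h * h' : stabilizer G t) : G)) ≫ b.π t =
      (b.ι t ≫ End.asHom (ρ h') ≫ b.π t) ≫ (b.ι t ≫ End.asHom (ρ h) ≫ b.π t)
    rw [Subgroup.coe_mul]
    exact (transfer_comp_transfer_of_smul_eq b ρ hb hρ (mem_stabilizer_iff.1 h'.2) (mem_stabilizer_iff.1 h.2)).symm

omit [Fintype T] in
/-- The stabiliser action is determined by `α(h) = ι_t ≫ ρ(h) ≫ π_t`. [cite: SerreLinearRepresentations1977, §7.1 Prop. 19] -/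
theorem stabilizerAction_unique {t : T} {α α' : stabilizer G t →* End Y}
    (hα : ∀ h : stabilizer G t, End.asHom (α h) = b.ι t ≫ End.asHom (ρ h) ≫ b.π t)
    (hα' : ∀ h : stabilizer G t, End.asHom (α' h) = b.ι t ≫ End.asHom (ρ h) ≫ b.π t) : α = α' :=
  MonoidHom.ext fun h ↦ (hα h).trans (hα' h).symm

omit [Fintype T] in
/-- **Restriction to a subgroup preserves imprimitivity** (`Res_L` of an imprimitive system over `T` is imprimitive for `L`,
its transitive pieces being the `L`-orbits on `T` — for `T = G/H` the double cosets `L \ G / H`: Mackey's decomposition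
`Res_L Ind_H^G W = ⊕_{LgH} Ind_{L ∩ gHg⁻¹}^L W^g`). [cite: SerreLinearRepresentations1977, §7.3 Prop. 22] -/
theorem restrict (hρ : ∀ (g : G) (t u : T), g • t ≠ u → b.ι t ≫ End.asHom (ρ g) ≫ b.π u = 0) (L : Subgroup G) :
    ∀ (l : L) (t u : T), l • t ≠ u → b.ι t ≫ End.asHom ((ρ.comp L.subtype) l) ≫ b.π u = 0 :=
  fun l t u h ↦ hρ (l : G) t u h

omit [Fintype T] in
/-- **Permutation powers are imprimitive** with all transfer maps `𝟙`: `ι_s ≫ ρ(g) = ι_{g s}` gives `ι_s ρ(g) π_u = 0` for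
`u ≠ g s` — `A^S = ⊕` of the induced actions `Ind_{Stab(s)}^G A` (trivial action of the stabiliser) over the orbits.
[cite: SerreLinearRepresentations1977, §3.3 Example 2] -/
theorem of_permAction (hρ : ∀ (g : G) (t : T), b.ι t ≫ End.asHom (ρ g) = b.ι (g • t)) :
    ∀ (g : G) (t u : T), g • t ≠ u → b.ι t ≫ End.asHom (ρ g) ≫ b.π u = 0 := fun g t u h ↦ by
  rw [← Category.assoc, hρ, bicone_ι_π_ne b h]

omit [Fintype T] in
/-- For a permutation power the transfer maps are identities: `ι_s ≫ ρ(g) ≫ π_{g s} = 𝟙` (the stabiliser acts trivially: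
`A^{G/H} = Ind_H^G A` for the unit action). [cite: SerreLinearRepresentations1977, §3.3 Example 2] -/
theorem transfer_eq_id_of_permAction (hρ : ∀ (g : G) (t : T), b.ι t ≫ End.asHom (ρ g) = b.ι (g • t)) (g : G) (t : T) :
    b.ι t ≫ End.asHom (ρ g) ≫ b.π (g • t) = 𝟙 Y := by
  rw [← Category.assoc, hρ]
  exact bicone_ι_π_self b (g • t)

omit [Fintype T] in
/-- **Twisted (monomial) permutation actions are imprimitive**: `ι_s ≫ ρ(g) = β(g) ≫ ι_{g s}` for an action `β : G → End Y`
gives `ι_s ρ(g) π_u = 0` for `u ≠ g s`; over a transitive `S ∋ s₀` this is `Ind_H^G (Res_H β)`, `H = Stab(s₀)`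
(`Ind(Res β ⊗ 1) = β ⊗ Ind 1`). [cite: SerreLinearRepresentations1977, §3.3 Example 5] -/
theorem of_twistedPermAction (β : G →* End Y)
    (hρ : ∀ (g : G) (t : T), b.ι t ≫ End.asHom (ρ g) = End.asHom (β g) ≫ b.ι (g • t)) :
    ∀ (g : G) (t u : T), g • t ≠ u → b.ι t ≫ End.asHom (ρ g) ≫ b.π u = 0 := fun g t u h ↦ by
  rw [← Category.assoc, hρ, Category.assoc, bicone_ι_π_ne b h, comp_zero]

omit [Fintype T] in
/-- For a twisted permutation action the transfer maps are `β(g)`: `ι_s ≫ ρ(g) ≫ π_{g s} = β(g)`.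
[cite: SerreLinearRepresentations1977, §3.3 Example 5] -/
theorem transfer_eq_of_twistedPermAction (β : G →* End Y)
    (hρ : ∀ (g : G) (t : T), b.ι t ≫ End.asHom (ρ g) = End.asHom (β g) ≫ b.ι (g • t)) (g : G) (t : T) :
    b.ι t ≫ End.asHom (ρ g) ≫ b.π (g • t) = End.asHom (β g) := by
  rw [← Category.assoc, hρ, Category.assoc, bicone_ι_π_self]
  exact Category.comp_id _

end Calculus

/-! ## §2 The `ℓ`-adic character of an imprimitive action and the induced character formula -/

section Character

variable (ℓ : ℕ) [Fact ℓ.Prime] {Y : AbelianVariety K} {T : Type} [Fintype T] (b : Bicone (fun _ : T ↦ Y))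
  {G : Type} [Group G] [MulAction G T] (ρ : G →* End b.pt)

/-- **Only the fixed summands contribute to the trace: `Tr(ρ(g) | T_ℓ X) = Σ_{t ∈ T^g} Tr(ι_t ρ(g) π_t | T_ℓ Y)`**
(`ℓ` invertible in `K`): the diagonal block `ι_t ρ(g) π_t` vanishes unless `g t = t` ("if `r⁻¹ u r ∉ H` the block is off the
diagonal and contributes nothing to the trace" — the proof of Serre's Thm. 12). [cite: SerreLinearRepresentations1977, §3.3 Thm. 12 (proof)]
[cite: MumfordAV1970, §19 Thm. 4 (p. 180)] -/
theorem trace_tateModuleMap_asHom_eq_sum_filter [DecidableEq T] (hb : ∑ t, b.π t ≫ b.ι t = 𝟙 b.pt)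
    (hρ : ∀ (g : G) (t u : T), g • t ≠ u → b.ι t ≫ End.asHom (ρ g) ≫ b.π u = 0) (hℓ : (ℓ : K) ≠ 0) (g : G) :
    LinearMap.trace ℤ_[ℓ] (b.pt.tateModule ℓ) (tateModuleMap ℓ (End.asHom (ρ g))) =
      ∑ t ∈ Finset.univ.filter (fun t ↦ g • t = t),
        LinearMap.trace ℤ_[ℓ] (Y.tateModule ℓ) (tateModuleMap ℓ (b.ι t ≫ End.asHom (ρ g) ≫ b.π t)) := by
  rw [trace_tateModuleMap_permPower_eq_sum ℓ b hb hℓ, Finset.sum_filter]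
  refine Finset.sum_congr rfl fun t _ ↦ ?_
  split_ifs with h
  · rfl
  · rw [hρ g t t h, tateModuleMap_zero, map_zero]

/-- **Conjugation rule for the diagonal blocks**: if `g` fixes `x t`, then
`Tr(ι_{xt} ρ(g) π_{xt} | T_ℓ Y) = Tr(ι_t ρ(x⁻¹ g x) π_t | T_ℓ Y)` — the block of `g` at `x t` is conjugate, by the transfer
isomorphism `φ_{x,t} : Y_t ≅ Y_{xt}`, to the block of `x⁻¹ g x` at `t` ("`χ_θ(r⁻¹ u r)`").
[cite: SerreLinearRepresentations1977, §3.3 Thm. 12 (proof)] -/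
theorem trace_tateModuleMap_transfer_smul_eq (hb : ∑ t, b.π t ≫ b.ι t = 𝟙 b.pt)
    (hρ : ∀ (g : G) (t u : T), g • t ≠ u → b.ι t ≫ End.asHom (ρ g) ≫ b.π u = 0) (hℓ : (ℓ : K) ≠ 0) {g x : G}
    {t : T} (hx : g • x • t = x • t) :
    LinearMap.trace ℤ_[ℓ] (Y.tateModule ℓ) (tateModuleMap ℓ (b.ι (x • t) ≫ End.asHom (ρ g) ≫ b.π (x • t))) =
      LinearMap.trace ℤ_[ℓ] (Y.tateModule ℓ) (tateModuleMap ℓ (b.ι t ≫ End.asHom (ρ (x⁻¹ * g * x)) ≫ b.π t)) := by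
  haveI := Y.module_free_tateModule_holds ℓ hℓ
  haveI := module_finite_tateModule_of_cast_ne_zero Y ℓ hℓ
  have h1 := ι_comp_asHom_eq b ρ hb hρ x t
  have h2 := ι_comp_asHom_eq b ρ hb hρ g (x • t)
  rw [hx] at h2
  have key : b.ι t ≫ End.asHom (ρ (x⁻¹ * g * x)) ≫ b.π t =
      (b.ι t ≫ End.asHom (ρ x) ≫ b.π (x • t)) ≫ (b.ι (x • t) ≫ End.asHom (ρ g) ≫ b.π (x • t)) ≫
        (b.ι (x • t) ≫ End.asHom (ρ x⁻¹) ≫ b.π t) := by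
    rw [asHom_map_mul_eq_comp, asHom_map_mul_eq_comp]
    simp only [Category.assoc]
    rw [reassoc_of% h1, reassoc_of% h2]
  rw [key]
  conv_rhs => rw [tateModuleMap_comp, LinearMap.trace_comp_comm', ← tateModuleMap_comp, Category.assoc,
    transfer_inv_comp_transfer b ρ hb hρ x t]
  erw [Category.comp_id]

/-- For a transitive action, `x ↦ x t₀` is `|Stab(t₀)|`-to-one onto `T`: `Σ_{x ∈ G} F(x t₀) = |Stab(t₀)| · Σ_{t ∈ T} F(t)`
(private helper). [folklore] -/
private theorem sum_apply_smul_eq_card_stabilizer_smul [Fintype G] [IsPretransitive G T] (t₀ : T)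
    {M : Type*} [AddCommMonoid M] (F : T → M) :
    ∑ x : G, F (x • t₀) = Nat.card (stabilizer G t₀) • ∑ t : T, F t := by
  classical
  have hfib : ∀ t : T, (Finset.univ.filter fun x : G ↦ x • t₀ = t).card = Nat.card (stabilizer G t₀) := by
    intro t
    obtain ⟨x₀, hx₀⟩ := exists_smul_eq G t₀ t
    have e : {x : G // x • t₀ = t} ≃ stabilizer G t₀ :=
      { toFun := fun x ↦ ⟨x₀⁻¹ * x.1, by rw [mem_stabilizer_iff, mul_smul, x.2, ← hx₀, inv_smul_smul]⟩
        invFun := fun h ↦ ⟨x₀ * (h : G), by rw [mul_smul, mem_stabilizer_iff.mp h.2, hx₀]⟩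
        left_inv := fun x ↦ Subtype.ext (mul_inv_cancel_left x₀ x.1)
        right_inv := fun h ↦ Subtype.ext (inv_mul_cancel_left x₀ (h : G)) }
    rw [← Nat.card_congr e, Nat.card_eq_fintype_card, Fintype.card_subtype]
  rw [← Finset.sum_fiberwise Finset.univ (fun x : G ↦ x • t₀) (fun x ↦ F (x • t₀)), Finset.smul_sum]
  refine Finset.sum_congr rfl fun t _ ↦ ?_
  rw [Finset.sum_congr rfl (fun x hx ↦ by rw [(Finset.mem_filter.mp hx).2] :
      ∀ x ∈ Finset.univ.filter (fun x : G ↦ x • t₀ = t), F (x • t₀) = F t), Finset.sum_const, hfib t]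

omit [Fintype T] in
/-- `x⁻¹ g x` fixes `t₀` iff `g` fixes `x t₀` (private helper). [folklore] -/
private theorem conj_smul_eq_iff (g x : G) (t₀ : T) : (x⁻¹ * g * x) • t₀ = t₀ ↔ g • x • t₀ = x • t₀ := by
  rw [mul_smul, mul_smul, inv_smul_eq_iff]

/-- **The character of an induced action (Serre's Theorem 12)**: for `T` transitive, `t₀ ∈ T` with stabiliser `H`,
**`|H| · Tr(ρ(g) | T_ℓ X) = Σ_{x ∈ G, (x⁻¹gx) t₀ = t₀} Tr(ι_{t₀} ρ(x⁻¹ g x) π_{t₀} | T_ℓ Y)`**, i.e.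
`χ_X(g) = |H|⁻¹ Σ_{x ∈ G, x⁻¹gx ∈ H} χ_Y(x⁻¹ g x) = (Ind_H^G χ_Y)(g)` for the `ℓ`-adic character `χ_Y` of the stabiliser action
`α(h) = ι_{t₀} ρ(h) π_{t₀}` ("`χ_ρ(u) = (1/h) Σ_{s ∈ G, s⁻¹us ∈ H} χ_θ(s⁻¹us)`"; `ℓ` invertible in `K`, `G` finite).
[cite: SerreLinearRepresentations1977, §3.3 Thm. 12] [cite: MumfordAV1970, §19 Thm. 4 (p. 180)] -/
theorem card_stabilizer_mul_trace_tateModuleMap_asHom_eq_sum [Fintype G] [DecidableEq T] [IsPretransitive G T]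
    (hb : ∑ t, b.π t ≫ b.ι t = 𝟙 b.pt)
    (hρ : ∀ (g : G) (t u : T), g • t ≠ u → b.ι t ≫ End.asHom (ρ g) ≫ b.π u = 0) (hℓ : (ℓ : K) ≠ 0) (t₀ : T)
    (g : G) :
    (Nat.card (stabilizer G t₀) : ℤ_[ℓ]) * LinearMap.trace ℤ_[ℓ] (b.pt.tateModule ℓ) (tateModuleMap ℓ (End.asHom (ρ g))) =
      ∑ x : G, if (x⁻¹ * g * x) • t₀ = t₀ then
        LinearMap.trace ℤ_[ℓ] (Y.tateModule ℓ) (tateModuleMap ℓ (b.ι t₀ ≫ End.asHom (ρ (x⁻¹ * g * x)) ≫ b.π t₀))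
        else 0 := by
  set F : T → ℤ_[ℓ] := fun t ↦ if g • t = t then
    LinearMap.trace ℤ_[ℓ] (Y.tateModule ℓ) (tateModuleMap ℓ (b.ι t ≫ End.asHom (ρ g) ≫ b.π t)) else 0 with hF
  have hFx : ∀ x : G, (if (x⁻¹ * g * x) • t₀ = t₀ then
      LinearMap.trace ℤ_[ℓ] (Y.tateModule ℓ) (tateModuleMap ℓ (b.ι t₀ ≫ End.asHom (ρ (x⁻¹ * g * x)) ≫ b.π t₀))
      else 0) = F (x • t₀) := by
    intro x
    by_cases h : g • x • t₀ = x • t₀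
    · rw [if_pos ((conj_smul_eq_iff g x t₀).2 h)]
      simp only [hF, h, ↓reduceIte]
      exact (trace_tateModuleMap_transfer_smul_eq ℓ b ρ hb hρ hℓ h).symm
    · rw [if_neg (fun h' ↦ h ((conj_smul_eq_iff g x t₀).1 h'))]
      simp only [hF, h, ↓reduceIte]
  rw [Finset.sum_congr rfl fun x _ ↦ hFx x, sum_apply_smul_eq_card_stabilizer_smul t₀ F, nsmul_eq_mul,
    trace_tateModuleMap_asHom_eq_sum_filter ℓ b ρ hb hρ hℓ g, Finset.sum_filter]

/-- **`dim Ind_H^G Y = [G : H] · dim Y`** for a transitive `T ∋ t₀`, `H = Stab(t₀)` ("`dim(V) = (G : H) · dim(W)`"; the power has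
`dim X = |T| dim Y`, `Motives/AbelianVarietyPermutationPowerCharacter`, and `|T| = [G : Stab(t₀)]`).
[cite: SerreLinearRepresentations1977, §3.3 Definition (ii)] -/
theorem dim_eq_index_stabilizer_mul [IsPretransitive G T] (hb : ∑ t, b.π t ≫ b.ι t = 𝟙 b.pt) (t₀ : T) :
    b.pt.dim = (stabilizer G t₀).index * Y.dim := by
  rw [dim_permPower_eq_card_mul b hb, index_stabilizer_of_transitive, Nat.card_eq_fintype_card]

end Character

/-! ## §3 Frobenius reciprocity against class functions and `dim B_G(Ind_H^G Y) = dim B_H(Y)` -/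

section Reciprocity

variable (ℓ : ℕ) [Fact ℓ.Prime] {Y : AbelianVariety K} {T : Type} [Fintype T] (b : Bicone (fun _ : T ↦ Y))
  {G : Type} [Group G] [Fintype G] [MulAction G T] [IsPretransitive G T] (ρ : G →* End b.pt) (t₀ : T)
  [Fintype (stabilizer G t₀)] (α : stabilizer G t₀ →* End Y)

/-- **Frobenius reciprocity against a class function** (`ℓ` invertible in `K`): for `c : G → ℤ_ℓ` constant on conjugacy
classes and the stabiliser action `α(h) = ι_{t₀} ρ(h) π_{t₀}` of `H = Stab(t₀)` (`T` transitive),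
**`|H| · Σ_{g ∈ G} c(g) Tr(ρ(g) | T_ℓ X) = |G| · Σ_{h ∈ H} c(h) Tr(α(h) | T_ℓ Y)`** — `⟨c, Ind_H^G χ_Y⟩_G = ⟨Res_H c, χ_Y⟩_H`
("the maps `Res` and `Ind` are adjoints of each other"; from Thm. 12 by the substitution `g ↦ x g x⁻¹`).
[cite: SerreLinearRepresentations1977, §7.2 Thm. 13 and Remark (1)] [cite: SerreLinearRepresentations1977, §3.3 Thm. 12] -/
theorem card_stabilizer_mul_sum_mul_trace_eq (hb : ∑ t, b.π t ≫ b.ι t = 𝟙 b.pt)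
    (hρ : ∀ (g : G) (t u : T), g • t ≠ u → b.ι t ≫ End.asHom (ρ g) ≫ b.π u = 0) (hℓ : (ℓ : K) ≠ 0)
    (hα : ∀ h : stabilizer G t₀, End.asHom (α h) = b.ι t₀ ≫ End.asHom (ρ h) ≫ b.π t₀)
    (c : G → ℤ_[ℓ]) (hc : ∀ g x : G, c (x⁻¹ * g * x) = c g) :
    (Fintype.card (stabilizer G t₀) : ℤ_[ℓ]) *
        ∑ g, c g * LinearMap.trace ℤ_[ℓ] (b.pt.tateModule ℓ) (tateModuleMap ℓ (End.asHom (ρ g))) =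
      (Fintype.card G : ℤ_[ℓ]) *
        ∑ h : stabilizer G t₀, c h * LinearMap.trace ℤ_[ℓ] (Y.tateModule ℓ) (tateModuleMap ℓ (End.asHom (α h))) := by
  classical
  -- the blocks of `ρ` at `t₀`, as a function on `G` supported on `H`
  set F : G → ℤ_[ℓ] := fun k ↦ if k • t₀ = t₀ then
    c k * LinearMap.trace ℤ_[ℓ] (Y.tateModule ℓ) (tateModuleMap ℓ (b.ι t₀ ≫ End.asHom (ρ k) ≫ b.π t₀)) else 0 with hF
  -- right-hand side: `|G| · Σ_{k ∈ G} F(k)`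
  have hR : ∑ h : stabilizer G t₀, c h * LinearMap.trace ℤ_[ℓ] (Y.tateModule ℓ) (tateModuleMap ℓ (End.asHom (α h))) =
      ∑ k, F k := by
    rw [hF, ← Finset.sum_filter, Finset.sum_subtype (Finset.univ.filter fun k : G ↦ k • t₀ = t₀)
      (p := fun k ↦ k ∈ stabilizer G t₀) (fun k ↦ by simp [mem_stabilizer_iff])]
    exact Finset.sum_congr rfl fun h _ ↦ by rw [hα h]
  -- left-hand side, by Thm. 12 and the substitution `g ↦ x g x⁻¹`
  have hL : (Fintype.card (stabilizer G t₀) : ℤ_[ℓ]) *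
      ∑ g, c g * LinearMap.trace ℤ_[ℓ] (b.pt.tateModule ℓ) (tateModuleMap ℓ (End.asHom (ρ g))) =
      ∑ x : G, ∑ k, F k := by
    rw [Finset.mul_sum]
    have h1 : ∀ g : G, (Fintype.card (stabilizer G t₀) : ℤ_[ℓ]) *
        (c g * LinearMap.trace ℤ_[ℓ] (b.pt.tateModule ℓ) (tateModuleMap ℓ (End.asHom (ρ g)))) =
        ∑ x : G, F (x⁻¹ * g * x) := by
      intro g
      rw [mul_left_comm, ← Nat.card_eq_fintype_card,
        card_stabilizer_mul_trace_tateModuleMap_asHom_eq_sum ℓ b ρ hb hρ hℓ t₀ g, Finset.mul_sum]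
      refine Finset.sum_congr rfl fun x _ ↦ ?_
      rw [hF]
      dsimp only
      rw [hc g x]
      split_ifs <;> simp
    rw [Finset.sum_congr rfl fun g _ ↦ h1 g, Finset.sum_comm]
    refine Finset.sum_congr rfl fun x _ ↦ ?_
    exact Fintype.sum_equiv (MulAut.conj x⁻¹).toEquiv _ _ fun g ↦ by
      simp [mul_assoc]
  rw [hL, hR, Finset.sum_const, Finset.card_univ, nsmul_eq_mul]

/-- **`⟨Ind_H^G χ_Y, 1⟩_G = ⟨χ_Y, 1⟩_H`: `|H| · Σ_{g ∈ G} Tr(ρ(g) | T_ℓ X) = |G| · Σ_{h ∈ H} Tr(α(h) | T_ℓ Y)`** (Frobenius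
reciprocity against the unit character). [cite: SerreLinearRepresentations1977, §7.2 Thm. 13] -/
theorem card_stabilizer_mul_sum_trace_eq (hb : ∑ t, b.π t ≫ b.ι t = 𝟙 b.pt)
    (hρ : ∀ (g : G) (t u : T), g • t ≠ u → b.ι t ≫ End.asHom (ρ g) ≫ b.π u = 0) (hℓ : (ℓ : K) ≠ 0)
    (hα : ∀ h : stabilizer G t₀, End.asHom (α h) = b.ι t₀ ≫ End.asHom (ρ h) ≫ b.π t₀) :
    (Fintype.card (stabilizer G t₀) : ℤ_[ℓ]) *
        ∑ g, LinearMap.trace ℤ_[ℓ] (b.pt.tateModule ℓ) (tateModuleMap ℓ (End.asHom (ρ g))) =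
      (Fintype.card G : ℤ_[ℓ]) *
        ∑ h : stabilizer G t₀, LinearMap.trace ℤ_[ℓ] (Y.tateModule ℓ) (tateModuleMap ℓ (End.asHom (α h))) := by
  have h := card_stabilizer_mul_sum_mul_trace_eq ℓ b ρ t₀ α hb hρ hℓ hα (fun _ ↦ 1) (fun _ _ ↦ rfl)
  simpa only [one_mul] using h

omit [Fact ℓ.Prime] in
/-- **`dim B_G(Ind_H^G Y) = dim B_H(Y)`** (any field; `T` transitive, `H = Stab(t₀)`, `α(h) = ι_{t₀} ρ(h) π_{t₀}`): the Kani–Rosen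
factor of the trivial representation of the induced action, `B_G(X) = Im N_G`, `N_G = Σ_g ρ(g)`, has the dimension of the factor
`B_H(Y) = Im N_H`, `N_H = Σ_{h ∈ H} α(h)`, of the inducing action — "`(Ind_H^G W)^G ≅ W^H`": `|G| · 2 dim B_G(X) = Σ_g χ_X(g)`,
`|H| · 2 dim B_H(Y) = Σ_h χ_Y(h)` for an auxiliary prime `ℓ` invertible in `K`, and Frobenius reciprocity against `1`.
[cite: SerreLinearRepresentations1977, §7.2 Thm. 13] [cite: KaniRosen1989, §3 Thm. B] [cite: LangeRodriguez2022, §2.9.1 Prop. 2.9.3 (PDF p. 46)]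
[cite: DokchitserEtAl2022, §3 (`V_ℓ(B_H) ≅ V_ℓ(X)^H`)] -/
theorem dim_image_normG_eq_dim_image_norm_stabilizer (hb : ∑ t, b.π t ≫ b.ι t = 𝟙 b.pt)
    (hρ : ∀ (g : G) (t u : T), g • t ≠ u → b.ι t ≫ End.asHom (ρ g) ≫ b.π u = 0)
    (hα : ∀ h : stabilizer G t₀, End.asHom (α h) = b.ι t₀ ≫ End.asHom (ρ h) ≫ b.π t₀)
    {NG : b.pt ⟶ b.pt} (hNG : End.of NG = ∑ g, ρ g) {NH : Y ⟶ Y} (hNH : End.of NH = ∑ h : stabilizer G t₀, α h) :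
    (image NG).dim = (image NH).dim := by
  obtain ⟨ℓ', hℓ'p, hℓ'⟩ := exists_prime_natCast_ne_zero (K := K)
  haveI : Fact ℓ'.Prime := ⟨hℓ'p⟩
  have h1 := card_mul_two_mul_dim_image_normG_eq_sum_trace_tateModuleMap ℓ' ρ hNG hℓ'
  have h2 := card_mul_two_mul_dim_image_normG_eq_sum_trace_tateModuleMap ℓ' α hNH hℓ'
  have h3 := card_stabilizer_mul_sum_trace_eq ℓ' b ρ t₀ α hb hρ hℓ' hα
  rw [← h1, ← h2, ← Nat.cast_mul, ← Nat.cast_mul] at h3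
  have h4 := Nat.cast_injective (R := ℤ_[ℓ']) h3
  have h5 : Fintype.card (stabilizer G t₀) * Fintype.card G * 2 * (image NG).dim =
      Fintype.card (stabilizer G t₀) * Fintype.card G * 2 * (image NH).dim := by
    calc Fintype.card (stabilizer G t₀) * Fintype.card G * 2 * (image NG).dim
        = Fintype.card (stabilizer G t₀) * (Fintype.card G * (2 * (image NG).dim)) := by ring
      _ = Fintype.card G * (Fintype.card (stabilizer G t₀) * (2 * (image NH).dim)) := h4
      _ = Fintype.card (stabilizer G t₀) * Fintype.card G * 2 * (image NH).dim := by ring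
  exact Nat.eq_of_mul_eq_mul_left (mul_pos (mul_pos Fintype.card_pos Fintype.card_pos) two_pos) h5

end Reciprocity

end Imprimitive

end AbelianVariety

end Literature.AlgebraicGeometry.Motives
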